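import Mathlib
import Summits.NavierStokesRegularity.NavierStokesRegularity.Theorems.FilamentSkeletonRssSkeletonJ1LSingleDatum

/-!
# `SkeletonJ1L` (stmt-NavierStokesRegularity-23296) from ONE SELF-CERTIFIED PAIR at ONE tolerance — no child item needed
# (the parent is `∃ Rb`, not `∀ Rb`; clause 12 is the theorem ⟨23322⟩; clause 13 certified for the witness only)

The route's split feeds the parent through three ∀-statements (heart ⟨23320⟩ ∀ data ∀ small `Rb`, clause-13 child ⟨23321⟩ ∀ skeletons of the class,
normal block ⟨23322⟩ ∀ skeletons — the last a THEOREM, `stub_normalBlockL`).  But the parent decl `SkeletonJ1L` itself asks for ONE set of constants —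
in particular ONE tolerance `Rb > 0` — and, for all large `Γ`, ONE skeleton whose matrix `J1LMatrix` holds (flat clauses + clause 12 + clause 13-J).
`skeletonJ1L_of_selfCertifiedPair` records the shortest honest route to it as an importable theorem: `Theses.FilamentSkeletonRss.SkeletonJ1L` BY NAME from
a SELF-CERTIFIED PAIR FAMILY — box constants, ONE `Rb > 0`, clause-13 constants `a ≥ 0`, `b`, `cnd > 0`, a threshold `Γ₂`, and for every `Γ ≥ Γ₂` two
unit-speed `C²` curves with slips and zeros satisfying (i) the twelve CURVE clauses of `FlatJ1L` for the UNIT-CORE field at the landed symmetric-pair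
parameters (`γ ≡ 125π/108`, `α = 875/432`; `Theorems.TangentSkeletonLCurveCore`), (ii) tangent oscillation `≤ Rb` and `|w′| ≤ Λ` (only to invoke
⟨23322⟩), and (iii) the clause-13-J certificate `Clause13J1G` FOR THIS SKELETON (unit cores).  Neither ⟨23320⟩ nor ⟨23321⟩ is invoked.
(The flat part (i)–(ii) reduces further to ONE curve in the `R_π` class: `Theorems.SkeletonJ1LSymmetricPair`, `…SymmetricStreamline`.)
HONEST FRAMING: bookkeeping (logic over landed theorems) about a HYPOTHETICAL filament skeleton on the NEGATIVE side of a MODEL route; producing such a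
family IS the open content (existence = heart at one datum/one tolerance; certificate = clause 13 at the witness); nothing here bears on Navier–Stokes
regularity or blow-up.  `--supports stmt-NavierStokesRegularity-23296`. [folklore]
-/

set_option linter.dupNamespace false

noncomputable section

namespace Summit.NavierStokesRegularity.NavierStokesRegularity.Theorems.SkeletonJ1LSelfCertified

open Filter
open scoped InnerProductSpace BigOperators
open Literature.Analysis.FluidPDE
open Summit.NavierStokesRegularity.NavierStokesRegularity.Theorems.FilamentSkeletonRssSkeletonJ1GSplit
  (Clause12J1G Clause13J1G NearStraightJ1G)
open Summit.NavierStokesRegularity.NavierStokesRegularity.Theorems.FilamentSkeletonRssSkeletonJ1LSplit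
  (J1LMatrix FlatJ1L NormalBlockMatchedLS skeletonJ1L_iff_matrix route_normalBlockMatchedL_iff)
open Summit.NavierStokesRegularity.NavierStokesRegularity.Theorems.TangentSkeletonLCurveCore (flatJ1L_of_unitCore nearStraightJ1G_of_unitCore)
open Summit.NavierStokesRegularity.NavierStokesRegularity.Theorems.FilamentSkeletonRssNormalBlockMatchedL (stub_normalBlockL)

/-- ★ **`SkeletonJ1L` BY NAME from ONE self-certified pair family at ONE tolerance `Rb`.** [folklore] -/
theorem skeletonJ1L_of_selfCertifiedPair
    (h : ∃ (δ ρ K Λ Rw Rb cg θ₀ a b cnd Γ₂ : ℝ), 0 < δ ∧ 0 < ρ ∧ 0 < Rw ∧ 0 < Rb ∧ 0 < cg ∧ 0 < θ₀ ∧ 0 ≤ a ∧ 0 < cnd ∧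
        2 * K * ρ ≤ 1 ∧ 1 ≤ Λ ∧ ∀ Γ : ℝ, Γ₂ ≤ Γ →
          ∃ (X : Fin 2 → ℝ → EuclideanSpace ℝ (Fin 3)) (w : Fin 2 → ℝ → ℝ) (c : Fin 2 → ℝ),
            (∀ (u : (Fin 2 → ℝ → EuclideanSpace ℝ (Fin 3)) → EuclideanSpace ℝ (Fin 3) → EuclideanSpace ℝ (Fin 3))
              (v : EuclideanSpace ℝ (Fin 3) → EuclideanSpace ℝ (Fin 3)),
              (∀ Z y, u Z y = ∑ k, (Γ*((fun _ : Fin 2 => 125 * Real.pi / 108) k)/(4*Real.pi))•∫ σ:ℝ, ((‖y-Z k σ‖^2+Real.exp (-(1+Real.eulerMascheroniConstant-Real.log 2)))^(3/2:ℝ))⁻¹•cross (deriv (Z k) σ) (y-Z k σ)) →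
              (∀ y, v y = u X y+(1/2:ℝ)•y-(875/432 : ℝ)•cross (EuclideanSpace.single 2 1) y) →
              ((875/432 : ℝ) ≠ 0 ∧ (∀ j : Fin 2, (fun _ : Fin 2 => 125 * Real.pi / 108) j ≠ 0) ∧
               (∀ j, ContDiff ℝ 2 (X j) ∧ Differentiable ℝ (w j) ∧ (∀ τ, ‖deriv (X j) τ‖ = 1) ∧ (∀ τ, ‖iteratedDeriv 2 (X j) τ‖*√Γ≤K) ∧
                 Tendsto (fun τ => ‖X j τ‖) (cocompact ℝ) atTop) ∧
               (∀ j k, j ≠ k → ∀ τ σ, ρ*√Γ≤‖X j τ-X k σ‖) ∧ (∀ j τ σ, ρ*√Γ≤|τ-σ| → cg*ρ*√Γ≤‖X j τ-X j σ‖) ∧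
               (∀ j τ, cg*|τ-c j|≤Rw*√Γ+‖X j τ‖) ∧ (∀ j τ, w j τ = ⟪v (X j τ), deriv (X j) τ⟫_ℝ) ∧
               (∀ j τ, ‖X j τ‖≤Rb*√(Γ*Real.log Γ) → v (X j τ) = w j τ•deriv (X j) τ) ∧ (∀ j, ‖X j (c j)‖≤Rw*√Γ) ∧
               (∀ j, |⟪deriv (X j) (c j), EuclideanSpace.single 2 1⟫_ℝ|≤1-θ₀) ∧
               (θ₀≤|(875/432 : ℝ)| ∧ |(875/432 : ℝ)|≤θ₀⁻¹ ∧ ∀ j : Fin 2, θ₀≤|(fun _ : Fin 2 => 125 * Real.pi / 108) j| ∧ |(fun _ : Fin 2 => 125 * Real.pi / 108) j|≤θ₀⁻¹) ∧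
               (∀ j, w j (c j) = 0 ∧ (∀ τ, w j τ = 0 → τ = c j) ∧ 3/2+δ≤deriv (w j) (c j) ∧ deriv (w j) (c j)≤Λ))) ∧
            (∀ j τ σ, ‖deriv (X j) τ - deriv (X j) σ‖ ≤ Rb) ∧ (∀ j τ, |deriv (w j) τ| ≤ Λ) ∧
            Clause13J1G 2 a b cnd Rb Γ (fun _ : Fin 2 => 125 * Real.pi / 108) (875/432 : ℝ) X w c (fun _ _ => 1)) :
    Summit.NavierStokesRegularity.NavierStokesRegularity.Theses.FilamentSkeletonRss.SkeletonJ1L := by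
  have h4 : NormalBlockMatchedLS := route_normalBlockMatchedL_iff.mp stub_normalBlockL
  refine skeletonJ1L_iff_matrix.mpr ?_
  set γ : Fin 2 → ℝ := fun _ => 125 * Real.pi / 108 with hγ
  set α : ℝ := 875 / 432 with hα
  have hN : 0 < 2 := by norm_num
  obtain ⟨δ, ρ, K, Λ, Rw, Rb, cg, θ₀, a, b, cnd, Γ₂, hδ, hρ, hRw, hRb, hcg, hθ₀, ha, hcnd, hKρ, hΛ1, hfam⟩ := h
  obtain ⟨Γ₁, h12⟩ := h4 2 δ ρ K Λ Rw Rb cg θ₀ 1 hN hδ hρ hRw hRb hcg hθ₀ hKρ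
  refine ⟨2, δ, ρ, K, Λ, a, b, cnd, 1, Rw, Rb, cg, θ₀, 1, max Γ₂ Γ₁, hN, hδ, hρ, ha, hcnd, one_pos, hRw, hRb, hcg, hθ₀, ?_⟩
  intro Γ hΓ
  have hΓ₂ : Γ₂ ≤ Γ := le_trans (le_max_left _ _) hΓ
  have hΓ₁ : Γ₁ ≤ Γ := le_trans (le_max_right _ _) hΓ
  obtain ⟨X, w, c, hcl, hosc, hw', hc13⟩ := hfam Γ hΓ₂
  have hflat : FlatJ1L 2 δ ρ K Λ Rw Rb cg θ₀ 1 Γ γ α X w c (fun _ _ => 1) := flatJ1L_of_unitCore hcl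
  have hns : NearStraightJ1G 2 Λ Rb X w (fun _ _ => 1) := nearStraightJ1G_of_unitCore hΛ1 hosc hw'
  obtain ⟨m, n, hc12⟩ := h12 Γ hΓ₁ γ α X w c (fun _ _ => 1) hflat hns
  refine ⟨γ, α, X, w, c, m, n, fun _ _ => 1, ?_⟩
  intro u v A T hu hv hA hT
  obtain ⟨k0, k1, k2, k3, k4, k5, k6, k7, k8, k9, k10, k11, k12, k13⟩ := hflat u v A T hu hv hA hT
  exact ⟨k0, k1, k2, k3, k4, k5, k6, k7, k8, k9, k10, k11, k12, k13, hc12 u v A T hu hv hA hT, hc13 u v A T hu hv hA hT⟩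

end Summit.NavierStokesRegularity.NavierStokesRegularity.Theorems.SkeletonJ1LSelfCertified

end
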